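import Mathlib.CategoryTheory.EssentialImage
import Mathlib.CategoryTheory.Comma.Over.Basic
import Mathlib.CategoryTheory.Limits.Shapes.BinaryProducts
import Literature.AnabelianGeometry.SemiGraphs.CosetCategories
import HarnessLib

/-!
# [IUTchI] Example 3.2 (i), (v): the REAL base categories `D_v ⊇ D⊢_v`, `Ÿ_v`, `D^Θ_v ⊆ (D_v)_{Ÿ_v}` at a bad place
# and the equivalence `D⊢_v ⥲ D^Θ_v`, "forming the product with `Ÿ_v`" (small coset models)

Mochizuki, *Inter-universal Teichmüller Theory I*, kurims manuscript (May 2020), Example 3.2 (i) p. 70 and (v)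
p. 72 [cite: Mochizuki2012, I Ex 3.2 (i)(v) pp.70-72] (D-0012 claim key, status disputed; nothing of the series is
asserted here — this file CONSTRUCTS small models and PROVES the elementary categorical sentences of (v) for them).

Print (i) p. 70: "`D_v` may be thought of as the category of connected tempered coverings — i.e., `B^temp(X̲̲_v)⁰` …
`D⊢_v := B(K_v)⁰` … may be naturally regarded [by pulling back finite étale coverings via the structure morphism
`X̲̲_v → Spec(K_v)`] as a full subcategory `D⊢_v ⊆ D_v` … a natural functor `D_v → D⊢_v`, which is left-adjoint to
the natural inclusion functor"; (ii) p. 70: "`Ÿ_v → X̲̲_v` … the tempered covering determined by the object `Ÿ^log`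
… we may think of `Ÿ_v` as an object of `D_v`"; (v) p. 72: "the base field of `Ÿ_v` is equal to `K_v` … Write
`D^Θ_v ⊆ (D_v)_{Ÿ_v}` for the full subcategory of the category `(D_v)_{Ÿ_v}` … determined by the products in `D_v` of
`Ÿ_v` with objects of `D⊢_v`. Thus, one verifies immediately that 'forming the product with `Ÿ_v`' determines a
natural equivalence of categories `D⊢_v ⥲ D^Θ_v`".

THE SMALL MODELS (as for [IUTchI] Ex. 3.3 (i) in `GoodLocalFrobenioidOfGalois.lean`, over abc-iut-L5-t2's
`CosetCategories.lean` [cite: MochizukiFrdII2008, Ex 1.3 (i)(ii) p.11]). INPUT = `BadLocalGroupDatum G Π_v`: on a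
topological group `Π_v` (print: the tempered fundamental group `Π^tp_{X̲̲_v}` — NOT constructed here) a continuous
OPEN homomorphism `aug : Π_v → G` (`G = G_v`, the absolute Galois group of `K_v`), and an open subgroup `Π_Ÿ ⊆ Π_v` (the
tempered covering `Ÿ_v`) with `aug(Π_Ÿ) = G` (print: "the base field of `Ÿ_v` is equal to `K_v`"; it forces `aug`
surjective). OUTPUT, all CONSTRUCTED: `D_v := CosetCat Π_v` ⊇ `D⊢_v := CosetCat G` via `CosetCat.pull aug` (full,
faithful) with left adjoint `CosetCat.push aug` (`CosetCat.pushPullAdj`); `Ÿ_v := ⟨Π_Ÿ⟩`; for `A = G/V ∈ D⊢_v` the object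
`Ÿ_v × A := Π_v/(Π_Ÿ ∩ aug⁻¹V)` with its two projections, PROVED to be a binary PRODUCT in `D_v` (`prodIsLimit`: the
double coset space `Π_Ÿ \ Π_v / aug⁻¹V` is one point because `Π_v = Π_Ÿ · Ker(aug)`); the functor
`prodFunctor : D⊢_v ⥤ (D_v)_{Ÿ_v}`, `A ↦ (Ÿ_v × A → Ÿ_v)`, PROVED full and faithful; `D^Θ_v :=` its essential image — the
full subcategory of `(D_v)_{Ÿ_v}` on the objects isomorphic to a product `Ÿ_v × A` — with the (full, faithful) inclusion
`dThetaIncl`; and `prodEquiv : D⊢_v ≌ D^Θ_v`, the equivalence "forming the product with `Ÿ_v`" (Mathlib's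
`Functor.asEquivalence` of the co-restriction, an equivalence because it is full, faithful and essentially surjective).
Pure topological-group / category theory over Mathlib. Consumers: the sibling files assembling abc-iut-L5-t2's frozen
interface `BadLocalFrobenioid l K_v` (`BadLocalFrobenioid.lean`) from REAL pieces.
-/

noncomputable section

namespace Literature.IUT.HodgeTheaters

open CategoryTheory CategoryTheory.Limits Literature.AnabelianGeometry.SemiGraphs

universe u

/-- **INPUT of [IUTchI] Ex. 3.2 at a bad place `v`** (group-theoretic shadow of the tempered curve `X̲̲_v` and of its
covering `Ÿ_v`): on a topological group `P = Π_v` ("`Π^tp_{X̲̲_v}`"), a continuous open homomorphism `aug : Π_v → G`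
("the structure morphism `X̲̲_v → Spec(K_v)`", `G = G_v`), and an open subgroup `Π_Ÿ ⊆ Π_v` ("the tempered covering
`Ÿ_v → X̲̲_v` determined by the object `Ÿ^log`", Ex. 3.2 (ii) p. 70) with `aug(Π_Ÿ) = G` ("the base field of `Ÿ_v` is
equal to `K_v`", Ex. 3.2 (v) p. 72). [cite: Mochizuki2012, I Ex 3.2 (i)(v) pp.70-72] -/
structure BadLocalGroupDatum (G : Type u) [Group G] [TopologicalSpace G] (P : Type u) [Group P]
    [TopologicalSpace P] : Type u where
  /-- the augmentation `Π_v → G_v` -/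
  aug : P →* G
  /-- `aug` is continuous -/
  continuous_aug : Continuous aug
  /-- `aug` is open -/
  isOpenMap_aug : IsOpenMap aug
  /-- the open subgroup `Π_Ÿ ⊆ Π_v` of the covering `Ÿ_v → X̲̲_v` -/
  Y : OpenSubgroup P
  /-- "the base field of `Ÿ_v` is equal to `K_v`": `aug(Π_Ÿ) = G_v` -/
  map_Y : Y.toSubgroup.map aug = ⊤

namespace BadLocalGroupDatum

variable {G : Type u} [Group G] [TopologicalSpace G] {P : Type u} [Group P] [TopologicalSpace P]
  (T : BadLocalGroupDatum G P)

/-- Every `g ∈ G` lifts to `Π_Ÿ`. [cite: Mochizuki2012, I Ex 3.2 (v) p.72] -/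
theorem exists_mem_Y_aug_eq (g : G) : ∃ y ∈ T.Y, T.aug y = g := by
  have h : g ∈ T.Y.toSubgroup.map T.aug := by rw [T.map_Y]; exact Subgroup.mem_top g
  exact Subgroup.mem_map.mp h

/-- `aug` is surjective. [cite: Mochizuki2012, I Ex 3.2 (v) p.72] -/
theorem surjective_aug : Function.Surjective T.aug := fun g => by
  obtain ⟨y, -, hy⟩ := T.exists_mem_Y_aug_eq g
  exact ⟨y, hy⟩

/-- `Π_v = Π_Ÿ · Ker(aug)`: every `x ∈ Π_v` is `y · k` with `y ∈ Π_Ÿ`, `aug k = 1`. [cite: Mochizuki2012, I Ex 3.2 (v) p.72] -/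
theorem exists_eq_mul_ker (x : P) : ∃ y ∈ T.Y, ∃ k : P, T.aug k = 1 ∧ x = y * k := by
  obtain ⟨y, hy, hyx⟩ := T.exists_mem_Y_aug_eq (T.aug x)
  exact ⟨y, hy, y⁻¹ * x, by rw [map_mul, map_inv, hyx, inv_mul_cancel], by rw [mul_inv_cancel_left]⟩

/-! ### (i) `D_v ⊇ D⊢_v` -/

/-- `D_v := 𝓑^temp(X̲̲_v)⁰`, modelled by the coset category of `Π_v`. [cite: Mochizuki2012, I Ex 3.2 (i) p.70] -/
abbrev Dv (_T : BadLocalGroupDatum G P) : Type u := CosetCat P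

/-- `D⊢_v := 𝓑(K_v)⁰`, modelled by the coset category of `G_v`. [cite: Mochizuki2012, I Ex 3.2 (i) p.70] -/
abbrev Ddash (_T : BadLocalGroupDatum G P) : Type u := CosetCat G

/-- `D⊢_v ⊆ D_v` "by pulling back finite étale coverings via the structure morphism". [cite: Mochizuki2012, I Ex 3.2 (i) p.70] -/
abbrev incl : T.Ddash ⥤ T.Dv := CosetCat.pull T.aug T.continuous_aug T.surjective_aug

/-- "a natural functor `D_v → D⊢_v`". [cite: Mochizuki2012, I Ex 3.2 (i) p.70] -/
abbrev proj : T.Dv ⥤ T.Ddash := CosetCat.push T.aug T.isOpenMap_aug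

/-- "… which is left-adjoint to the natural inclusion functor". [cite: Mochizuki2012, I Ex 3.2 (i) p.70] -/
abbrev adj : T.proj ⊣ T.incl := CosetCat.pushPullAdj T.aug T.continuous_aug T.surjective_aug T.isOpenMap_aug

/-- `D⊢_v ⊆ D_v` is full. [cite: Mochizuki2012, I Ex 3.2 (i) p.70] -/
theorem incl_full : T.incl.Full := CosetCat.pull_full _ _ _

/-- `D⊢_v ⊆ D_v` is faithful. [cite: Mochizuki2012, I Ex 3.2 (i) p.70] -/
theorem incl_faithful : T.incl.Faithful := CosetCat.pull_faithful _ _ _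

/-! ### (ii) `Ÿ_v`, and the products `Ÿ_v × A` -/

/-- `Ÿ_v` "as an object of `D_v`". [cite: Mochizuki2012, I Ex 3.2 (ii) p.70] -/
def ydd : T.Dv := ⟨T.Y⟩

/-- The open subgroup `Π_Ÿ ∩ aug⁻¹(V)` of `Ÿ_v × (G/V)`. [cite: Mochizuki2012, I Ex 3.2 (v) p.72] -/
def prodSg (V : OpenSubgroup G) : OpenSubgroup P := T.Y ⊓ V.comap T.aug T.continuous_aug

/-- Membership in `Π_Ÿ ∩ aug⁻¹(V)`. [cite: Mochizuki2012, I Ex 3.2 (v) p.72] -/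
theorem mem_prodSg {V : OpenSubgroup G} {π : P} : π ∈ T.prodSg V ↔ π ∈ T.Y ∧ T.aug π ∈ V :=
  Iff.rfl

/-- `Ÿ_v × A` for `A = G/V ∈ D⊢_v`: the object `Π_v/(Π_Ÿ ∩ aug⁻¹V)` of `D_v`. [cite: Mochizuki2012, I Ex 3.2 (v) p.72] -/
def prodObj (V : T.Ddash) : T.Dv := ⟨T.prodSg V.sg⟩

/-- The first projection `Ÿ_v × A → Ÿ_v`. [cite: Mochizuki2012, I Ex 3.2 (v) p.72] -/
def prodFst (V : T.Ddash) : T.prodObj V ⟶ T.ydd :=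
  CosetCat.homMk ((1 : P) : T.ydd.carrier) fun u hu => by
    rw [MulAction.Quotient.smul_coe, smul_eq_mul, mul_one]
    exact QuotientGroup.eq.mpr (by rw [mul_one, inv_mem_iff]; exact (T.mem_prodSg.mp hu).1)

/-- The second projection `Ÿ_v × A → A` (to `A` regarded in `D_v`). [cite: Mochizuki2012, I Ex 3.2 (v) p.72] -/
def prodSnd (V : T.Ddash) : T.prodObj V ⟶ T.incl.obj V :=
  CosetCat.homMk ((1 : P) : (T.incl.obj V).carrier) fun u hu => by
    rw [MulAction.Quotient.smul_coe, smul_eq_mul, mul_one]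
    exact QuotientGroup.eq.mpr (by rw [mul_one, inv_mem_iff]; exact (T.mem_prodSg.mp hu).2)

/-- The point of `pr₁` is `1 · Π_Ÿ`. [cite: Mochizuki2012, I Ex 3.2 (v) p.72] -/
@[simp] theorem pt_prodFst (V : T.Ddash) : CosetCat.pt (T.prodFst V) = ((1 : P) : T.ydd.carrier) :=
  CosetCat.pt_homMk _ _

/-- The point of `pr₂` is `1 · aug⁻¹V`. [cite: Mochizuki2012, I Ex 3.2 (v) p.72] -/
@[simp] theorem pt_prodSnd (V : T.Ddash) : CosetCat.pt (T.prodSnd V) = ((1 : P) : (T.incl.obj V).carrier) :=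
  CosetCat.pt_homMk _ _

/-- A pair of cosets `(a·Π_Ÿ, b·aug⁻¹V)` has a COMMON representative (one double coset: `Π_v = Π_Ÿ · Ker aug`).
[cite: Mochizuki2012, I Ex 3.2 (v) p.72] -/
theorem exists_common_rep (V : T.Ddash) (a : T.ydd.carrier) (b : (T.incl.obj V).carrier) :
    ∃ c : P, (c : T.ydd.carrier) = a ∧ (c : (T.incl.obj V).carrier) = b := by
  refine QuotientGroup.induction_on a fun α => QuotientGroup.induction_on b fun β => ?_
  obtain ⟨y, hy, k, hk, hyk⟩ := T.exists_eq_mul_ker (α⁻¹ * β)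
  refine ⟨α * y, QuotientGroup.eq.mpr ?_, QuotientGroup.eq.mpr ?_⟩
  · rw [mul_inv_rev, inv_mul_cancel_right, inv_mem_iff]
    exact hy
  · have h : (α * y)⁻¹ * β = k := by
      rw [mul_inv_rev, mul_assoc, hyk, inv_mul_cancel_left]
    rw [h]
    change k ∈ V.sg.comap T.aug T.continuous_aug
    rw [OpenSubgroup.mem_comap, hk]
    exact one_mem _

/-- Two common representatives define the same point of `Ÿ_v × A`. [cite: Mochizuki2012, I Ex 3.2 (v) p.72] -/
theorem coe_prodObj_eq_of_rep (V : T.Ddash) {c c' : P} (h₁ : (c : T.ydd.carrier) = (c' : T.ydd.carrier))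
    (h₂ : (c : (T.incl.obj V).carrier) = (c' : (T.incl.obj V).carrier)) :
    (c : (T.prodObj V).carrier) = (c' : (T.prodObj V).carrier) :=
  QuotientGroup.eq.mpr (T.mem_prodSg.mpr ⟨QuotientGroup.eq.mp h₁, QuotientGroup.eq.mp h₂⟩)

/-- The projections of the point `c · (Π_Ÿ ∩ aug⁻¹V)`. [cite: Mochizuki2012, I Ex 3.2 (v) p.72] -/
theorem prodFst_toFun_coe (V : T.Ddash) (c : P) :
    CosetCat.Hom.toFun (T.prodFst V) (c : (T.prodObj V).carrier) = (c : T.ydd.carrier) := by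
  rw [CosetCat.toFun_coe, pt_prodFst, MulAction.Quotient.smul_coe, smul_eq_mul, mul_one]

/-- The projections of the point `c · (Π_Ÿ ∩ aug⁻¹V)`. [cite: Mochizuki2012, I Ex 3.2 (v) p.72] -/
theorem prodSnd_toFun_coe (V : T.Ddash) (c : P) :
    CosetCat.Hom.toFun (T.prodSnd V) (c : (T.prodObj V).carrier) = (c : (T.incl.obj V).carrier) := by
  rw [CosetCat.toFun_coe, pt_prodSnd, MulAction.Quotient.smul_coe, smul_eq_mul, mul_one]

/-- **Two morphisms into `Ÿ_v × A` agreeing after both projections are equal.** [cite: Mochizuki2012, I Ex 3.2 (v) p.72] -/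
theorem prod_hom_ext (V : T.Ddash) {W : T.Dv} {m m' : W ⟶ T.prodObj V}
    (h₁ : m ≫ T.prodFst V = m' ≫ T.prodFst V) (h₂ : m ≫ T.prodSnd V = m' ≫ T.prodSnd V) : m = m' := by
  obtain ⟨c, hc⟩ := Quotient.exists_rep (CosetCat.pt m)
  obtain ⟨c', hc'⟩ := Quotient.exists_rep (CosetCat.pt m')
  have e₁ := congrArg CosetCat.pt h₁
  have e₂ := congrArg CosetCat.pt h₂
  rw [CosetCat.pt_comp, CosetCat.pt_comp, ← hc, ← hc'] at e₁ e₂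
  change CosetCat.Hom.toFun (T.prodFst V) (c : (T.prodObj V).carrier) =
    CosetCat.Hom.toFun (T.prodFst V) (c' : (T.prodObj V).carrier) at e₁
  change CosetCat.Hom.toFun (T.prodSnd V) (c : (T.prodObj V).carrier) =
    CosetCat.Hom.toFun (T.prodSnd V) (c' : (T.prodObj V).carrier) at e₂
  rw [prodFst_toFun_coe, prodFst_toFun_coe] at e₁
  rw [prodSnd_toFun_coe, prodSnd_toFun_coe] at e₂
  apply CosetCat.hom_ext
  rw [← hc, ← hc']
  exact T.coe_prodObj_eq_of_rep V e₁ e₂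

/-- A chosen common representative of `(pt a, pt b)` for a pair of morphisms `W → Ÿ_v`, `W → A`.
[cite: Mochizuki2012, I Ex 3.2 (v) p.72] -/
def liftRep (V : T.Ddash) {W : T.Dv} (a : W ⟶ T.ydd) (b : W ⟶ T.incl.obj V) : P :=
  Classical.choose (T.exists_common_rep V (CosetCat.pt a) (CosetCat.pt b))

/-- Its defining property. [cite: Mochizuki2012, I Ex 3.2 (v) p.72] -/
theorem liftRep_spec (V : T.Ddash) {W : T.Dv} (a : W ⟶ T.ydd) (b : W ⟶ T.incl.obj V) :
    (T.liftRep V a b : T.ydd.carrier) = CosetCat.pt a ∧ (T.liftRep V a b : (T.incl.obj V).carrier) = CosetCat.pt b :=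
  Classical.choose_spec (T.exists_common_rep V (CosetCat.pt a) (CosetCat.pt b))

/-- **The pairing `(a, b) : W → Ÿ_v × A`** of `a : W → Ÿ_v` and `b : W → A`. [cite: Mochizuki2012, I Ex 3.2 (v) p.72] -/
def prodLift (V : T.Ddash) {W : T.Dv} (a : W ⟶ T.ydd) (b : W ⟶ T.incl.obj V) : W ⟶ T.prodObj V :=
  CosetCat.homMk (T.liftRep V a b : (T.prodObj V).carrier) fun w hw => by
    rw [MulAction.Quotient.smul_coe, smul_eq_mul]
    obtain ⟨e₁, e₂⟩ := T.liftRep_spec V a b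
    refine T.coe_prodObj_eq_of_rep V ?_ ?_
    · rw [← smul_eq_mul, ← MulAction.Quotient.smul_coe, e₁, CosetCat.smul_pt a hw]
    · rw [← smul_eq_mul, ← MulAction.Quotient.smul_coe, e₂, CosetCat.smul_pt b hw]

/-- `(a, b) ≫ pr₁ = a`. [cite: Mochizuki2012, I Ex 3.2 (v) p.72] -/
@[simp] theorem prodLift_fst (V : T.Ddash) {W : T.Dv} (a : W ⟶ T.ydd) (b : W ⟶ T.incl.obj V) :
    T.prodLift V a b ≫ T.prodFst V = a :=
  CosetCat.hom_ext (by
    rw [CosetCat.pt_comp, prodLift, CosetCat.pt_homMk, prodFst_toFun_coe, (T.liftRep_spec V a b).1])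

/-- `(a, b) ≫ pr₂ = b`. [cite: Mochizuki2012, I Ex 3.2 (v) p.72] -/
@[simp] theorem prodLift_snd (V : T.Ddash) {W : T.Dv} (a : W ⟶ T.ydd) (b : W ⟶ T.incl.obj V) :
    T.prodLift V a b ≫ T.prodSnd V = b :=
  CosetCat.hom_ext (by
    rw [CosetCat.pt_comp, prodLift, CosetCat.pt_homMk, prodSnd_toFun_coe, (T.liftRep_spec V a b).2])

/-- Uniqueness of the pairing. [cite: Mochizuki2012, I Ex 3.2 (v) p.72] -/
theorem prodLift_unique (V : T.Ddash) {W : T.Dv} (a : W ⟶ T.ydd) (b : W ⟶ T.incl.obj V) (m : W ⟶ T.prodObj V)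
    (h₁ : m ≫ T.prodFst V = a) (h₂ : m ≫ T.prodSnd V = b) : m = T.prodLift V a b :=
  T.prod_hom_ext V (by rw [h₁, prodLift_fst]) (by rw [h₂, prodLift_snd])

/-- **`Ÿ_v × A` IS a product in `D_v`** of `Ÿ_v` and (the pull-back of) `A ∈ D⊢_v` ("the products in `D_v` of `Ÿ_v`
with objects of `D⊢_v`") — PROVED for the coset model. [cite: Mochizuki2012, I Ex 3.2 (v) p.72] -/
def prodIsLimit (V : T.Ddash) : IsLimit (BinaryFan.mk (T.prodFst V) (T.prodSnd V)) :=
  BinaryFan.isLimitMk (fun s => T.prodLift V s.fst s.snd) (fun s => T.prodLift_fst V s.fst s.snd)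
    (fun s => T.prodLift_snd V s.fst s.snd) (fun s m h₁ h₂ => T.prodLift_unique V s.fst s.snd m h₁ h₂)

/-! ### (v) "forming the product with `Ÿ_v`": the functor `D⊢_v → (D_v)_{Ÿ_v}` -/

/-- `Ÿ_v × f` for `f : A → A'` in `D⊢_v`: the pairing of `pr₁` and `pr₂ ≫ f`. [cite: Mochizuki2012, I Ex 3.2 (v) p.72] -/
def prodMap {V V' : T.Ddash} (f : V ⟶ V') : T.prodObj V ⟶ T.prodObj V' :=
  T.prodLift V' (T.prodFst V) (T.prodSnd V ≫ T.incl.map f)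

/-- `(Ÿ_v × f) ≫ pr₁ = pr₁`. [cite: Mochizuki2012, I Ex 3.2 (v) p.72] -/
@[simp] theorem prodMap_fst {V V' : T.Ddash} (f : V ⟶ V') : T.prodMap f ≫ T.prodFst V' = T.prodFst V :=
  T.prodLift_fst _ _ _

/-- `(Ÿ_v × f) ≫ pr₂ = pr₂ ≫ f`. [cite: Mochizuki2012, I Ex 3.2 (v) p.72] -/
@[simp] theorem prodMap_snd {V V' : T.Ddash} (f : V ⟶ V') :
    T.prodMap f ≫ T.prodSnd V' = T.prodSnd V ≫ T.incl.map f :=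
  T.prodLift_snd _ _ _

/-- `Ÿ_v × 𝟙 = 𝟙`. [cite: Mochizuki2012, I Ex 3.2 (v) p.72] -/
@[simp] theorem prodMap_id (V : T.Ddash) : T.prodMap (𝟙 V) = 𝟙 (T.prodObj V) :=
  (T.prodLift_unique V _ _ _ (Category.id_comp _)
    (by rw [CategoryTheory.Functor.map_id, Category.comp_id, Category.id_comp])).symm

/-- `Ÿ_v × (f ≫ g) = (Ÿ_v × f) ≫ (Ÿ_v × g)`. [cite: Mochizuki2012, I Ex 3.2 (v) p.72] -/
theorem prodMap_comp {V V' V'' : T.Ddash} (f : V ⟶ V') (g : V' ⟶ V'') :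
    T.prodMap (f ≫ g) = T.prodMap f ≫ T.prodMap g :=
  (T.prodLift_unique V'' _ _ _ (by rw [Category.assoc, prodMap_fst, prodMap_fst])
    (by rw [Category.assoc, prodMap_snd, ← Category.assoc, prodMap_snd, Category.assoc,
      CategoryTheory.Functor.map_comp])).symm

/-- `A^Θ := (Ÿ_v × A → Ÿ_v)`, an object of the slice `(D_v)_{Ÿ_v}`. [cite: Mochizuki2012, I Ex 3.2 (v) p.72] -/
def prodOver (V : T.Ddash) : Over T.ydd := Over.mk (T.prodFst V)

/-- **"forming the product with `Ÿ_v`"**: the functor `D⊢_v ⥤ (D_v)_{Ÿ_v}`, `A ↦ A^Θ := Ÿ_v × A`.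
[cite: Mochizuki2012, I Ex 3.2 (v) p.72] -/
def prodFunctor : T.Ddash ⥤ Over T.ydd where
  obj V := T.prodOver V
  map f := Over.homMk (T.prodMap f) (T.prodMap_fst f)
  map_id V := Over.OverMorphism.ext (by change T.prodMap (𝟙 V) = 𝟙 (T.prodObj V); exact T.prodMap_id V)
  map_comp f g := Over.OverMorphism.ext (by
    change T.prodMap (f ≫ g) = T.prodMap f ≫ T.prodMap g
    exact T.prodMap_comp f g)

/-- `prodFunctor` on objects. [cite: Mochizuki2012, I Ex 3.2 (v) p.72] -/
@[simp] theorem prodFunctor_obj (V : T.Ddash) : T.prodFunctor.obj V = T.prodOver V := rfl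

/-- `prodFunctor` on morphisms (underlying map in `D_v`). [cite: Mochizuki2012, I Ex 3.2 (v) p.72] -/
@[simp] theorem prodFunctor_map_left {V V' : T.Ddash} (f : V ⟶ V') : (T.prodFunctor.map f).left = T.prodMap f := rfl

/-- `prodFunctor ⋙ forget = A ↦ Ÿ_v × A`. [cite: Mochizuki2012, I Ex 3.2 (v) p.72] -/
@[simp] theorem prodFunctor_obj_left (V : T.Ddash) : (T.prodFunctor.obj V).left = T.prodObj V := rfl

/-- For a morphism `h : A^Θ → A'^Θ` OVER `Ÿ_v` with point `π·(Π_Ÿ ∩ aug⁻¹V')`, the coset `aug(π)·V'` is `V`-fixed: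
`V = aug(Π_Ÿ ∩ aug⁻¹V)` fixes the point. [cite: Mochizuki2012, I Ex 3.2 (v) p.72] -/
theorem smul_aug_rep_eq {V V' : T.Ddash} (h : T.prodObj V ⟶ T.prodObj V') (π : P)
    (hπ : CosetCat.pt h = (π : (T.prodObj V').carrier)) :
    ∀ v ∈ V.sg, v • ((T.aug π : G) : V'.carrier) = ((T.aug π : G) : V'.carrier) := by
  intro v hv
  obtain ⟨u, hu, huv⟩ := T.exists_mem_Y_aug_eq v
  have hfix := CosetCat.smul_pt h (T.mem_prodSg.mpr ⟨hu, by rw [huv]; exact hv⟩ : u ∈ (T.prodObj V).sg)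
  rw [hπ, MulAction.Quotient.smul_coe, smul_eq_mul] at hfix
  have hmem := (T.mem_prodSg.mp (QuotientGroup.eq.mp hfix)).2
  rw [map_mul, map_inv, map_mul, huv] at hmem
  rw [MulAction.Quotient.smul_coe, smul_eq_mul]
  exact QuotientGroup.eq.mpr hmem

/-- The `D⊢_v`-morphism `A → A'` underlying a morphism `h : Ÿ_v × A → Ÿ_v × A'` over `Ÿ_v`: point `aug(π)·V'` for
`π·(Π_Ÿ ∩ aug⁻¹V')` the point of `h`. [cite: Mochizuki2012, I Ex 3.2 (v) p.72] -/
def preimageOver {V V' : T.Ddash} (h : T.prodObj V ⟶ T.prodObj V') : V ⟶ V' :=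
  CosetCat.homMk ((T.aug (Quotient.out (CosetCat.pt h)) : G) : V'.carrier)
    (T.smul_aug_rep_eq h _ (Quotient.out_eq _).symm)

/-- `Ÿ_v × (preimageOver h) = h` for `h` over `Ÿ_v`. [cite: Mochizuki2012, I Ex 3.2 (v) p.72] -/
theorem prodMap_preimageOver {V V' : T.Ddash} (h : T.prodObj V ⟶ T.prodObj V') (w : h ≫ T.prodFst V' = T.prodFst V) :
    T.prodMap (T.preimageOver h) = h := by
  symm
  refine T.prodLift_unique V' _ _ _ w (CosetCat.hom_ext ?_)
  have hπ : CosetCat.pt h = ((Quotient.out (CosetCat.pt h) : P) : (T.prodObj V').carrier) :=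
    (Quotient.out_eq _).symm
  rw [CosetCat.pt_comp, CosetCat.pt_comp, hπ, pt_prodSnd, prodSnd_toFun_coe]
  change _ = CosetCat.pt (T.incl.map (T.preimageOver h))
  rw [CosetCat.pt_pull_map, preimageOver, CosetCat.pt_homMk, Equiv.eq_symm_apply]
  exact CosetCat.pullEquiv_coe _ _ _ _ _

/-- **`A ↦ Ÿ_v × A` is FULL** (into the slice over `Ÿ_v`). [cite: Mochizuki2012, I Ex 3.2 (v) p.72] -/
theorem prodFunctor_full : T.prodFunctor.Full where
  map_surjective h := ⟨T.preimageOver h.left, Over.OverMorphism.ext (by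
    change T.prodMap (T.preimageOver h.left) = h.left
    exact T.prodMap_preimageOver h.left (Over.w h))⟩

/-- **`A ↦ Ÿ_v × A` is FAITHFUL.** [cite: Mochizuki2012, I Ex 3.2 (v) p.72] -/
theorem prodFunctor_faithful : T.prodFunctor.Faithful where
  map_injective {V V'} f f' hff' := by
    have h : T.prodMap f = T.prodMap f' := by
      rw [← prodFunctor_map_left, ← prodFunctor_map_left, hff']
    have h2 : T.prodSnd V ≫ T.incl.map f = T.prodSnd V ≫ T.incl.map f' := by
      rw [← prodMap_snd, ← prodMap_snd, h]
    have h3 : CosetCat.pt (T.incl.map f) = CosetCat.pt (T.incl.map f') := by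
      have := congrArg CosetCat.pt h2
      rw [CosetCat.pt_comp, CosetCat.pt_comp, pt_prodSnd] at this
      exact this
    exact T.incl_faithful.map_injective (CosetCat.hom_ext h3)

/-! ### (v) `D^Θ_v ⊆ (D_v)_{Ÿ_v}` and `D⊢_v ⥲ D^Θ_v` -/

/-- **`D^Θ_v`**: "the full subcategory of the category `(D_v)_{Ÿ_v}` determined by the products in `D_v` of `Ÿ_v` with
objects of `D⊢_v`" — the essential image of `A ↦ Ÿ_v × A` (objects of the slice isomorphic to some `A^Θ`).
[cite: Mochizuki2012, I Ex 3.2 (v) p.72] -/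
abbrev DTheta : Type u := T.prodFunctor.EssImageSubcategory

/-- The inclusion `D^Θ_v ⊆ (D_v)_{Ÿ_v}` (full and faithful). [cite: Mochizuki2012, I Ex 3.2 (v) p.72] -/
abbrev dThetaIncl : T.DTheta ⥤ Over T.ydd := T.prodFunctor.essImage.ι

/-- `D^Θ_v ⊆ (D_v)_{Ÿ_v}` is full. [cite: Mochizuki2012, I Ex 3.2 (v) p.72] -/
theorem dThetaIncl_full : T.dThetaIncl.Full := inferInstance

/-- `D^Θ_v ⊆ (D_v)_{Ÿ_v}` is faithful. [cite: Mochizuki2012, I Ex 3.2 (v) p.72] -/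
theorem dThetaIncl_faithful : T.dThetaIncl.Faithful := inferInstance

/-- "forming the product with `Ÿ_v`" co-restricted to `D^Θ_v`: `D⊢_v ⥤ D^Θ_v`, `A ↦ A^Θ := Ÿ_v × A`.
[cite: Mochizuki2012, I Ex 3.2 (v) p.72] -/
abbrev prodToDTheta : T.Ddash ⥤ T.DTheta := T.prodFunctor.toEssImage

/-- It is an equivalence (full, faithful, essentially surjective). [cite: Mochizuki2012, I Ex 3.2 (v) p.72] -/
theorem prodToDTheta_isEquivalence : T.prodToDTheta.IsEquivalence :=
  haveI := T.prodFunctor_full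
  haveI := T.prodFunctor_faithful
  { }

/-- **"'forming the product with `Ÿ_v`' determines a natural equivalence of categories `D⊢_v ⥲ D^Θ_v`"** — CONSTRUCTED
for the coset model. [cite: Mochizuki2012, I Ex 3.2 (v) p.72] -/
def prodEquiv : T.Ddash ≌ T.DTheta :=
  haveI := T.prodToDTheta_isEquivalence
  T.prodToDTheta.asEquivalence

/-- The functor of `prodEquiv` IS `A ↦ A^Θ`. [cite: Mochizuki2012, I Ex 3.2 (v) p.72] -/
theorem prodEquiv_functor : T.prodEquiv.functor = T.prodToDTheta := rfl

/-- `prodEquiv` followed by the inclusion into the slice is `A ↦ (Ÿ_v × A → Ÿ_v)` (up to the canonical isomorphism).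
[cite: Mochizuki2012, I Ex 3.2 (v) p.72] -/
def prodEquivCompInclIso : T.prodEquiv.functor ⋙ T.dThetaIncl ≅ T.prodFunctor := T.prodFunctor.toEssImageCompι

/-- … and then by `(D_v)_{Ÿ_v} → D_v` it is `A ↦ Ÿ_v × A` on the nose on objects. [cite: Mochizuki2012, I Ex 3.2 (v) p.72] -/
theorem prodEquiv_obj_left (V : T.Ddash) : (T.dThetaIncl.obj (T.prodEquiv.functor.obj V)).left = T.prodObj V := rfl

end BadLocalGroupDatum

end Literature.IUT.HodgeTheaters

end
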